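import Literature.Analysis.Complex.HydrodynamicExpansion
import Mathlib.Analysis.Complex.OpenMapping
import HarnessLib

/-!
# Complements on the capacity coefficient of a hydrodynamically normalized map

Continuation of `Literature.Analysis.Complex.HydrodynamicExpansion` (Lawler, *Conformally
Invariant Processes in the Plane* (2005), §3.4, the half-plane capacity `hcap` and Prop. 3.46),
again function-theoretically (typically real functions, Rogosinski) instead of with Brownian
motion. For `g` hydrodynamically normalized and symmetric outside `B̄(x₀, r)`
(`IsHydrodynamicAt g x₀ r`) with capacity coefficient `a = hcapAt g x₀ ≥ 0`:

* `Literature.Analysis.Complex.IsTypicallyReal.eq_zero_of_deriv_eq_zero` — a typically real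
  `f` with `f'(0) = 0` vanishes identically (open mapping theorem for Rogosinski's `p`,
  `Re p ≥ 0`, `p(0) = 0`);
* `Literature.Analysis.Complex.IsHydrodynamicAt.eq_self_of_hcapAt_eq_zero` — **`a = 0` forces
  `g = id`** on `{|z - x₀| > r}` (so the hull of a nonempty half-plane hull has `hcap > 0`,
  Lawler (2005), (3.8)–(3.10));
* `…norm_sub_sub_div_le'`, `…norm_sub_self_le'` — the expansion
  `|g(z) - z - a/(z - x₀)| ≤ 6 a r/|z - x₀|²` and `|g(z) - z| ≤ 4a/|z - x₀|` (`|z - x₀| ≥ 2r`)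
  of Prop. 3.46 WITHOUT the hypothesis `a > 0`;
* `…hcapAt_le` — **`a ≤ 288 r²`** when moreover `Im g ≥ 0` on the upper exterior (the maps
  `g_A` of hulls; Lawler (2005), (3.9) `hcap(A) ≤ rad(A)²`, here with a harmless constant and
  without the monotonicity of `hcap`), and `…norm_sub_self_le_of_im_nonneg`:
  `|g(z) - z| ≤ 576 r` for `|z - x₀| ≥ 2r` (cf. (3.12));
* `…hcapAt_eq_hcapAt` — the coefficient does not depend on the centre: it is
  `lim z (g(z) - z)`; `…congr`, `…hcapAt_congr` — bookkeeping. (The radius monotonicity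
  `IsHydrodynamicAt.mono` is in `HydrodynamicDisplacement`.)

## References

* G. F. Lawler, *Conformally Invariant Processes in the Plane*, AMS (2005), §3.4, (3.8)–(3.12),
  Prop. 3.46. [Lawler2005]
* W. Rogosinski, *Über positive harmonische Entwicklungen und typisch-reelle Potenzreihen*,
  Math. Z. 35 (1932) 93–121; P. L. Duren, *Univalent Functions* (1983), §2.8.
-/

noncomputable section

open Set Filter Metric Bornology
open _root_.Complex _root_.Topology
open scoped ComplexConjugate

namespace Literature.Analysis.Complex

namespace IsTypicallyReal

variable {f : ℂ → ℂ}

/-- **A typically real function with `f'(0) = 0` vanishes identically.** Rogosinski's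
`p(z) = (1 - z²) f(z)/z` is holomorphic on the disc with `Re p ≥ 0` and `p(0) = f'(0) = 0`; by
the open mapping theorem `p` is constant (a nonconstant `p` would map the disc onto a
neighbourhood of `0`, meeting `Re < 0`), so `p ≡ 0` and `f ≡ 0`. [folklore] -/
theorem eq_zero_of_deriv_eq_zero (hf : IsTypicallyReal f) (h0 : deriv f 0 = 0) {z : ℂ}
    (hz : z ∈ ball (0 : ℂ) 1) : f z = 0 := by
  have hp : AnalyticOnNhd ℂ (rogosinski f) (ball 0 1) :=
    hf.differentiableOn_rogosinski.analyticOnNhd isOpen_ball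
  have hp0 : rogosinski f 0 = 0 := by rw [rogosinski_zero, h0]
  have hconst : ∀ w ∈ ball (0 : ℂ) 1, rogosinski f w = 0 := by
    rcases hp.is_constant_or_isOpen (convex_ball 0 1).isPreconnected with ⟨c, hc⟩ | hopen
    · intro w hw
      rw [hc w hw, ← hc 0 (mem_ball_self one_pos), hp0]
    · exfalso
      have himg : IsOpen (rogosinski f '' ball 0 1) := hopen _ Subset.rfl isOpen_ball
      have h0mem : (0 : ℂ) ∈ rogosinski f '' ball 0 1 := ⟨0, mem_ball_self one_pos, hp0⟩
      obtain ⟨ε, hε, hball⟩ := Metric.isOpen_iff.1 himg 0 h0mem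
      have hneg : (-(ε / 2 : ℝ) : ℂ) ∈ ball (0 : ℂ) ε := by
        rw [mem_ball_zero_iff, norm_neg, Complex.norm_real, Real.norm_of_nonneg (by positivity)]
        linarith
      obtain ⟨w, hw, hpw⟩ := hball hneg
      have h1 := hf.re_rogosinski_nonneg hw
      rw [hpw, neg_re, Complex.ofReal_re] at h1
      linarith
  rcases eq_or_ne z 0 with rfl | hz0
  · exact hf.map_zero
  have h1 := hconst z hz
  rw [hf.rogosinski_of_ne hz0] at h1
  have hz2 : 1 - z ^ 2 ≠ 0 := by
    intro h
    have hsq : z ^ 2 = 1 := by linear_combination -h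
    have : ‖z‖ ^ 2 = 1 := by rw [← norm_pow, hsq, norm_one]
    rw [mem_ball_zero_iff] at hz
    nlinarith [norm_nonneg z]
  rcases div_eq_zero_iff.1 h1 with h2 | h2
  · exact (mul_eq_zero.1 h2).resolve_left hz2
  · exact absurd h2 hz0

end IsTypicallyReal

namespace IsHydrodynamicAt

variable {g g' : ℂ → ℂ} {x₀ x₁ r r' : ℝ}

/-- Points outside `B̄(x₀, r)` form a co-compact set. [folklore] -/
theorem eventually_lt_norm_sub (x₀ r : ℝ) : ∀ᶠ z in cocompact ℂ, r < ‖z - (x₀ : ℂ)‖ := by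
  filter_upwards [(isCompact_closedBall (x₀ : ℂ) r).compl_mem_cocompact] with z hz
  rw [mem_compl_iff, mem_closedBall, dist_eq_norm, not_le] at hz
  exact hz

/-- The structure only depends on the values of `g` outside `B̄(x₀, r)`. [folklore] -/
theorem congr (h : IsHydrodynamicAt g x₀ r) (heq : ∀ z : ℂ, r < ‖z - x₀‖ → g' z = g z) :
    IsHydrodynamicAt g' x₀ r where
  pos := h.pos
  differentiableOn := h.differentiableOn.congr fun z hz ↦ heq z hz
  tendsto_sub := h.tendsto_sub.congr' (by
    filter_upwards [eventually_lt_norm_sub x₀ r] with z hz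
    rw [heq z hz])
  map_conj := fun z hz ↦ by
    have hcz : r < ‖conj z - x₀‖ := by
      rw [← Complex.conj_ofReal x₀, ← map_sub, Complex.norm_conj]; exact hz
    rw [heq z hz, heq _ hcz, h.map_conj z hz]
  im_le := fun z hz hzi ↦ by rw [heq z hz]; exact h.im_le z hz hzi

/-- … and so does the capacity coefficient. [folklore] -/
theorem hcapAt_congr (h : IsHydrodynamicAt g x₀ r) (heq : ∀ z : ℂ, r < ‖z - x₀‖ → g' z = g z) :
    hcapAt g' x₀ = hcapAt g x₀ := by
  unfold hcapAt
  congr 1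
  apply Filter.EventuallyEq.deriv_eq
  filter_upwards [ball_mem_nhds (0 : ℂ) (inv_pos.2 h.pos)] with w hw
  rcases eq_or_ne w 0 with rfl | hw0
  · simp
  rw [invertAt_of_ne hw0, invertAt_of_ne hw0, heq _ (h.lt_norm_of_mem_ball hw hw0)]

/-- **The rescaled inverted function `F(w) = f(w/r)` is typically real** on the unit disc.
[folklore] -/
theorem isTypicallyReal_invertAt (h : IsHydrodynamicAt g x₀ r) :
    IsTypicallyReal (fun w ↦ invertAt g x₀ ((r : ℂ)⁻¹ * w)) := by
  have hmem : ∀ w ∈ ball (0 : ℂ) 1, (r : ℂ)⁻¹ * w ∈ ball (0 : ℂ) r⁻¹ := fun w hw ↦ by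
    rw [mem_ball_zero_iff] at hw ⊢
    rw [norm_mul, norm_inv, Complex.norm_real, Real.norm_of_nonneg h.pos.le]
    exact mul_lt_of_lt_one_right (inv_pos.2 h.pos) hw
  exact
    { differentiableOn := h.differentiableOn_invertAt.comp
        ((differentiableOn_const _).mul differentiableOn_id) hmem
      map_zero := by simp
      im_nonneg := fun w hw hwi ↦ h.invertAt_im_nonneg (hmem w hw) (by
        rw [← Complex.ofReal_inv, Complex.im_ofReal_mul]; exact mul_nonneg (inv_nonneg.2 h.pos.le) hwi)
      im_nonpos := fun w hw hwi ↦ h.invertAt_im_nonpos (hmem w hw) (by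
        rw [← Complex.ofReal_inv, Complex.im_ofReal_mul]
        exact mul_nonpos_of_nonneg_of_nonpos (inv_nonneg.2 h.pos.le) hwi) }

/-- `F'(0) = a/r`. [folklore] -/
theorem deriv_invertAt_smul (h : IsHydrodynamicAt g x₀ r) :
    deriv (fun w ↦ invertAt g x₀ ((r : ℂ)⁻¹ * w)) 0 = (r : ℂ)⁻¹ * hcapAt g x₀ := by
  have hd : HasDerivAt (invertAt g x₀) (deriv (invertAt g x₀) 0) ((r : ℂ)⁻¹ * 0) := by
    rw [mul_zero]
    exact (h.differentiableOn_invertAt.differentiableAt (ball_mem_nhds 0 (inv_pos.2 h.pos))).hasDerivAt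
  have h1 : HasDerivAt (fun w : ℂ ↦ (r : ℂ)⁻¹ * w) (r : ℂ)⁻¹ 0 := by
    simpa using (hasDerivAt_id (0 : ℂ)).const_mul (r : ℂ)⁻¹
  have h2 : HasDerivAt (fun w ↦ invertAt g x₀ ((r : ℂ)⁻¹ * w))
      (deriv (invertAt g x₀) 0 * (r : ℂ)⁻¹) 0 := hd.comp 0 h1
  rw [h2.deriv, h.deriv_invertAt_eq]; ring

/-- **`a = 0` forces `g = id`** outside `B̄(x₀, r)`: the typically real `F` has `F'(0) = a/r = 0`,
hence vanishes, i.e. `g(z) - z = f(1/(z - x₀)) = 0`. In particular the map `g_A` of a hull with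
`A ∩ ℍ ≠ ∅` has `hcap(A) > 0` (Lawler (2005), (3.8)). [cite: Lawler2005, §3.4 (3.8)] -/
theorem eq_self_of_hcapAt_eq_zero (h : IsHydrodynamicAt g x₀ r) (ha : hcapAt g x₀ = 0) {z : ℂ}
    (hz : r < ‖z - x₀‖) : g z = z := by
  have hF := h.isTypicallyReal_invertAt
  have hd : deriv (fun w ↦ invertAt g x₀ ((r : ℂ)⁻¹ * w)) 0 = 0 := by
    rw [h.deriv_invertAt_smul, ha]; simp
  have hpos : 0 < ‖z - x₀‖ := h.pos.trans hz
  have hz0 : z - x₀ ≠ 0 := norm_pos_iff.1 hpos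
  have hr : (r : ℂ) ≠ 0 := by exact_mod_cast h.pos.ne'
  set w : ℂ := (r : ℂ) * (z - x₀)⁻¹ with hw
  have hwmem : w ∈ ball (0 : ℂ) 1 := by
    rw [mem_ball_zero_iff, hw, norm_mul, norm_inv, Complex.norm_real, Real.norm_of_nonneg h.pos.le]
    rw [← div_eq_mul_inv, div_lt_one hpos]
    exact hz
  have h1 := hF.eq_zero_of_deriv_eq_zero hd hwmem
  have h2 : (r : ℂ)⁻¹ * w = (z - x₀)⁻¹ := by rw [hw, ← mul_assoc, inv_mul_cancel₀ hr, one_mul]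
  simp only [h2] at h1
  rw [invertAt_inv_sub (sub_ne_zero.1 hz0)] at h1
  exact sub_eq_zero.1 h1

/-- **Prop. 3.46 without `a > 0`**: `|g(z) - z - a/(z - x₀)| ≤ 6 a r/|z - x₀|²` for
`|z - x₀| ≥ 2r`. [cite: Lawler2005, Prop. 3.46] -/
theorem norm_sub_sub_div_le' (h : IsHydrodynamicAt g x₀ r) {z : ℂ} (hz : 2 * r ≤ ‖z - x₀‖) :
    ‖g z - z - hcapAt g x₀ / (z - x₀)‖ ≤ 6 * hcapAt g x₀ * r / ‖z - x₀‖ ^ 2 := by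
  rcases h.hcapAt_nonneg.lt_or_eq with ha | ha
  · exact h.norm_sub_sub_div_le ha hz
  · have hz' : r < ‖z - x₀‖ := by linarith [h.pos]
    rw [← ha, h.eq_self_of_hcapAt_eq_zero ha.symm hz']
    simp

/-- `|g(z) - z| ≤ 4a/|z - x₀|` for `|z - x₀| ≥ 2r`, without `a > 0`. [cite: Lawler2005, Prop. 3.46] -/
theorem norm_sub_self_le' (h : IsHydrodynamicAt g x₀ r) {z : ℂ} (hz : 2 * r ≤ ‖z - x₀‖) :
    ‖g z - z‖ ≤ 4 * hcapAt g x₀ / ‖z - x₀‖ := by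
  rcases h.hcapAt_nonneg.lt_or_eq with ha | ha
  · exact h.norm_sub_self_le ha hz
  · have hz' : r < ‖z - x₀‖ := by linarith [h.pos]
    rw [← ha, h.eq_self_of_hcapAt_eq_zero ha.symm hz']
    simp

/-- **`a ≤ 288 r²` for maps into the closed upper half-plane.** If moreover `Im g ≥ 0` on the
upper exterior `{|z - x₀| > r, Im z > 0}` (as for the maps `g_A : ℍ ∖ A → ℍ` of hulls), then at
`z = x₀ - 12 r i` (lower half-plane, where `Im g(z) ≤ 0` by symmetry) the expansion gives
`a/(12 r) - 12 r ≤ |g(z) - z - a/(z - x₀)| ≤ a/(24 r)`. (Lawler (2005), (3.9):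
`hcap(A) ≤ rad(A)²`, by monotonicity; here a weaker constant, without monotonicity.)
[cite: Lawler2005, §3.4 (3.9)] -/
theorem hcapAt_le (h : IsHydrodynamicAt g x₀ r)
    (hnn : ∀ z : ℂ, r < ‖z - x₀‖ → 0 < z.im → 0 ≤ (g z).im) :
    hcapAt g x₀ ≤ 288 * r ^ 2 := by
  have hr := h.pos
  set a : ℝ := hcapAt g x₀ with ha_def
  set z : ℂ := (x₀ : ℂ) - ((12 * r : ℝ) : ℂ) * I with hz_def
  have hzx : z - x₀ = -(((12 * r : ℝ) : ℂ) * I) := by rw [hz_def]; ring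
  have hnorm : ‖z - x₀‖ = 12 * r := by
    rw [hzx, norm_neg, norm_mul, Complex.norm_real, Complex.norm_I, mul_one,
      Real.norm_of_nonneg (by positivity)]
  have h2r : 2 * r ≤ ‖z - x₀‖ := by rw [hnorm]; linarith
  have hzr : r < ‖z - x₀‖ := by rw [hnorm]; linarith
  have key := h.norm_sub_sub_div_le' h2r
  rw [hnorm] at key
  -- the right-hand side is `a/(24 r)`
  have hrhs : 6 * a * r / (12 * r) ^ 2 = a / (24 * r) := by
    field_simp; ring
  rw [← ha_def, hrhs] at key
  -- imaginary part of the left-hand side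
  have him_z : z.im = -(12 * r) := by simp [hz_def]
  have him_div : ((a : ℂ) / (z - x₀)).im = a / (12 * r) := by
    rw [hzx]
    simp only [Complex.div_im, Complex.ofReal_re, Complex.ofReal_im, Complex.neg_re,
      Complex.neg_im, Complex.mul_re, Complex.mul_im, Complex.I_re, Complex.I_im,
      Complex.normSq_neg, Complex.normSq_mul, Complex.normSq_I, Complex.normSq_ofReal]
    field_simp
    ring
  -- `Im g(z) ≤ 0`: the conjugate point lies in the upper exterior
  have hgim : (g z).im ≤ 0 := by
    have hcz : r < ‖conj z - x₀‖ := by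
      rw [← Complex.conj_ofReal x₀, ← map_sub, Complex.norm_conj]; exact hzr
    have hci : 0 < (conj z).im := by rw [Complex.conj_im, him_z, neg_neg]; positivity
    have h1 := hnn _ hcz hci
    have h2 : g z = conj (g (conj z)) := by rw [h.map_conj _ hzr, Complex.conj_conj]
    rw [h2, Complex.conj_im]
    linarith
  have him : (g z - z - a / (z - x₀)).im = (g z).im + 12 * r - a / (12 * r) := by
    rw [Complex.sub_im, Complex.sub_im, him_z, him_div]; ring
  have hle : -(g z - z - a / (z - x₀)).im ≤ a / (24 * r) :=
    (neg_le_abs _).trans ((Complex.abs_im_le_norm _).trans key)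
  rw [him] at hle
  -- `a/(12 r) - 12 r ≤ a/(24 r)`, i.e. `a ≤ 288 r²`
  have h3 : a / (12 * r) - 12 * r ≤ a / (24 * r) := by linarith
  have h4 : a / (12 * r) - a / (24 * r) = a / (24 * r) := by field_simp; ring
  have h5 : a / (24 * r) ≤ 12 * r := by linarith
  rwa [div_le_iff₀ (by positivity), show 12 * r * (24 * r) = 288 * r ^ 2 by ring] at h5

/-- **Uniform far-field bound** `|g(z) - z| ≤ 576 r` for `|z - x₀| ≥ 2r`, for maps into the
closed upper half-plane (Lawler (2005), (3.12): `|g_A(z) - z| ≤ 3 rad(A)`; here with a weaker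
constant). [cite: Lawler2005, §3.4 (3.12)] -/
theorem norm_sub_self_le_of_im_nonneg (h : IsHydrodynamicAt g x₀ r)
    (hnn : ∀ z : ℂ, r < ‖z - x₀‖ → 0 < z.im → 0 ≤ (g z).im) {z : ℂ} (hz : 2 * r ≤ ‖z - x₀‖) :
    ‖g z - z‖ ≤ 576 * r := by
  have hr := h.pos
  have hpos : 0 < ‖z - x₀‖ := by linarith
  have h1 := h.norm_sub_self_le' hz
  have h2 := h.hcapAt_le hnn
  calc ‖g z - z‖ ≤ 4 * hcapAt g x₀ / ‖z - x₀‖ := h1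
    _ ≤ 4 * (288 * r ^ 2) / (2 * r) := by
        gcongr
    _ = 576 * r := by field_simp; ring

/-- **The capacity coefficient does not depend on the centre**: both `(z - x₀)(g(z) - z)` and
`(z - x₁)(g(z) - z)` converge at `∞`, and their difference `(x₁ - x₀)(g(z) - z)` tends to `0`.
(Lawler (2005), Def. 3.37: `hcap = lim z (g(z) - z)`.) [cite: Lawler2005, §3.4 Def. 3.37] -/
theorem hcapAt_eq_hcapAt (h : IsHydrodynamicAt g x₀ r) (h' : IsHydrodynamicAt g x₁ r') :
    hcapAt g x₀ = hcapAt g x₁ := by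
  have h1 := h.tendsto_mul_sub_hcapAt
  have h2 := h'.tendsto_mul_sub_hcapAt
  have h3 := h1.sub h2
  have h5 : (fun z ↦ (z - x₀) * (g z - z) - (z - x₁) * (g z - z)) =
      fun z ↦ ((x₁ - x₀ : ℝ) : ℂ) * (g z - z) := by
    ext z; push_cast; ring
  rw [h5] at h3
  have h4 : Tendsto (fun z ↦ ((x₁ - x₀ : ℝ) : ℂ) * (g z - z)) (cocompact ℂ) (𝓝 0) := by
    simpa using h.tendsto_sub.const_mul ((x₁ - x₀ : ℝ) : ℂ)
  have h6 := tendsto_nhds_unique h3 h4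
  rw [sub_eq_zero] at h6
  exact_mod_cast h6

end IsHydrodynamicAt

end Literature.Analysis.Complex
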